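import Summits.RiemannHypothesis.RiemannHypothesis.Theorems.TiltedLandingLaw421R3RateGlue2A

/-! # TouchedDissipation-v3opt — (T′ = C′ OF RECORD, v2 bytes kept) + the `s`-CURRENCY OPTION (T″) (lens-2 g5; (O5-b), (CA614), (CA615); option for director-rh g25)
**v2 = v1 cdd815ffc14364c5 + ONE binder `ApproachLevelQ η f x₀ s hmax R Hs B j →` right after `Charged … j →` (director (CA614), crit-1 g4 CUT 21).**
v1 AS TYPED was KILLED (class MISSTATED) by crit-1's legal rational two-pair witness W1*: `f(w) = e^{40w}(w²+1)((w − 369/10000)² + (10065/10000)²)`,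
`(η,x₀,s,hmax,R,Hs,B) = (1/2, 0, 1/100, 1, 31/10, 10065/10000, 309)`, `j = 0`, `v = i`, `z = 369/10000 + (10065/10000)i`: touched ∧ atomic ∧ charged, a
CONSUMPTION level (`tentAt (3/2) f 0 v = 2`), `κ_v = 14.3154`, `X := (E − childEnergy)·κ_v² = 0.5143 < 1 ≤ c` (memo `crit-g4/cut21/CUT21-T-verdict.md`
6b4e9cc6ff59964b; mechanism: a near-coincident mate cancels part of the external field, `κ_v ≪ κ_ext`, while the dissipation follows `κ_ext` — the ORDER
parameter is `1/(κ_ext·‖v − z‖)`, not `1/(κ_v·Im v)`).  The glue only ever used (T) on β ⊆ APPROACH levels, so C′ := (T) + `ApproachLevelQ` is the law the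
books consume (`approach ⇒ ‖v − z‖ > (3/2)·Im v`, W1*'s family misses it); crit-1's toy bank: C′ has 0 violations at c = 1 on 179 024 approach touched-atomic
levels, min X = 1.684 (λ ∈ [2,3)) / 1.997 ([3,6)) / ≥ 2.4 above; instr-1 replay benches (`INSTRUMENT-v3-TPRICE.md` 7d831b676be00b1b, 22 886 touched ∧
charged ∧ atomic rows): no kill at (1,2)/(1,3)/(3/2,3), min X = 2.596, envelope X ≥ 3 − 4.33/λ; **CONSTANTS OF RECORD (director (CA615)): (c, κ₀) = (3/2, 3)**
(the constants stay PARAMETERS below; the ∃-form's admissible range `1 ≤ c`, `0 < κ₀` contains the record instance); c = 3 is dead as a constant.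
Everything below the line is v1's text with the binder threaded through `TouchedDissipationLawQ`, `_mono`, `sCurrency_at_level` (v1 prose kept for the record).
STATEMENT file for crux `TiltedLandingLaw421R` ⟨stmt-RiemannHypothesis-33346⟩, route EarlyAppointments; RATE residual ★A = `ApproachAllowanceQ
(approachBudgetHalfQ riseSupQ consSupQ)` (registry `Lines/trkD_v11q.lean` `stub_approachC`).  Typed ONLY after instr-1's decisive column
(`INSTRUMENT-v3-P1Q5.md` 30a20165 §DC) returned **QUADRATIC** (phase length ∝ (κ·Im v)², Q = 0.20–0.28 stable under κ-doubling; linear ratio ×3.2).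
THE LAW (director (CA588), TOUCH-MEMO-v2 43989801 §3/§6), in the DIMENSIONLESS currency the column prices: at a CHARGED level `j` whose lowest band
state `v` is disc-TOUCHED by a strictly taller zero `z` of `f⁽ʲ⁾` (`Touches`: `Im v < Im z`, `|Re v − Re z| ≤ Im v + Im z`), the pair `{v, z}` being
ATOMIC (every third upper zero is disc-separated from both — the two-pair cluster of W1 / lens-1's atomic class) and the state field not small
(FLOOR `κ₀ ≤ Im v·κ_v`, `κ_v := ‖tiltAt f j v‖` = the field of the OTHER zeros at `v`, the tree's `newtonK` with the partner's term removed = the column's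
κ_book), the PAIR ENERGY `E := Im v² + Im z²` exceeds the multiplicity-weighted energy of the upper children of `f⁽ʲ⁺¹⁾` off `Z(f⁽ʲ⁾)` inside the
closed two-disc union `Ū = D̄_v ∪ D̄_z` (exactly TWO by the W1 door `RhW08.ClusterCount.clusterCount` when the feet are clean) by at least `c/κ_v²`:
`c ≤ (E − Σ_{children u ∈ Ū} ord(u)·Im u²)·κ_v²`.  First-order value of the constant: 3 (own partners −1 each, touching conjugate cross term ≤ −1/2,
all other cross terms ≤ 0 by reciprocity); the column measures κ_book²·ΔE ≤ −3 + 4.3/(κ·Im v) (2 851 touched levels; max −1.11 on κ·Im v ∈ [2,3),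
−1.82 on [3,6), −2.53 on [6,12); qualitative failures ONLY at κ·Im v < 1.05 in 3–4-pair clusters), so the constants are PARAMETERS with the
existential form `TouchedDissipationLawQEx` (admissible: `1 ≤ c`, `0 < κ₀` — «a touching pair dissipates at least what one isolated pair does»;
record candidates (c, κ₀) = (1, 2) [data margin 10 %] and (1, 3) [45 %]; (3, ·) is the asymptote, not a law at finite κ·Im v).  The FLOOR is
structural, not a fudge: already for ONE isolated pair in a constant tilt `L` (lens-1's `Cruxes/…/Lens1_OnePairToy.lean`, `(t²+y²)e^{Lt}`) the children are
`−y/λ ± iy√(1−1/λ²)` for `λ = L·y > 1` — `ΔE·κ_v² = 1` EXACTLY (`κ_v = L`) — and REAL for `λ < 1`, where `ΔE·κ_v² = λ² < 1`: c = 1 needs κ₀ ≥ 1.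
WHY THIS SHAPE (vacuity audit): successors are localised by `Ū` and weighted by multiplicity, so the conclusion cannot be met by a foreign low zero
(a child outside `Ū` does not count) nor broken by a double child; the floor makes a MULTIPLE lowest zero (junk `newtonK = 0`, `Im v·κ_v = 1/2`) drop out
for `κ₀ > 1/2`; no lateral-isolation binder (approach levels violate it by definition — this is where ★A lives), no `s`-currency in the law (the cap
`κ_v ≤ (1+θ)η/s` is a separate currency question at the STATE on approach levels, see the glue sketch `Cruxes/TiltedLandingLaw421R/Lens2_TouchedGlueSketch.lean`).
GLUE ARITHMETIC (sketch file; (CA588)): under the cap, each such level lowers `Φ := (1+θ)²η²·E/(c·s²)` by ≥ 1 while `Φ ≤ (1+θ)²η²·2Hs²/(c s²) ≤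
(1+θ)²(Hs/s)²/(2c)` (`2η ≤ 1`): with c = 3 this is the director's `(1/6)(1+θ)²(Hs/s)² ≤ 0.17·(Hs/s)²`; with the admissible floor c = 1 it is
`≤ 0.51·(Hs/s)²`, next to the far class's `(5/4)·energyPurseQ ≤ (5/16)(Hs/s)²` — inside the purse's single `(Hs/s)²` term, no `4·hmax/s`, no new constant.
THE TWO HONEST GAPS OF THE LAW (CA585)/(CA588): **LOCALISATION** — the dissipation identity is first-order for a polynomial-like cluster; here the pair
sits inside a real entire function of order < 2 with far field κ, real zeros («teeth») and further pairs; the exact prototype, de Bruijn–Springer /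
Malamud–Pereira majorisation `Σ_children φ ≤ Σ_zeros φ` (φ convex) [corpus:paper:arxiv-math_0309233 p.18–19 Thm 10; Schmeisser doi:10.1007/bf03321027], is
GLOBAL over all zeros and critical points, and its local two-disc version with a quantified deficit is not in print to my knowledge; **ORDER** — `c/κ²`
is the first-order term; the remainder is O(1/(κ·Im v)) relative (column: 4.3/(κ·Im v)), whence the floor; all-orders control near close touching
(curvature `Σ m_k/(v − z_k)²` large) is open.  NOT CLAIMED: anything at sub-floor levels, at non-atomic clusters (P ≥ 3), about WHICH child is lower, or
about `lowH` itself (covered levels may rise: CE2-type anti-drop is legal in the approach class); the law is OPEN — typed, not proved; HOLD RULE: this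
file lands only when a proof elaborates against its bytes.  (K) items below are bookkeeping only.
**v3-OPTION (lens-2 g5, for director-rh g25; v2 = C′ OF RECORD is kept byte-for-byte below, this file only ADDS §2b/§3b).** The glue's state cap
Γ1 (`κ_v ≤ (1+θ)·η/s` on β-levels, θ = 1/200) has a CANDIDATE NEGATIVE «WΓ» by the W1* standard: `f = e^{−46w}(w² + 1/100)((w − 4/25)² + 1/25)`,
`(η, x₀, s, hmax, R, Hs, B) = (1/2, 0, 1/100, 1, 31/10, 1/5, 309)`, level 0, `v = i/10`, `z = 4/25 + i/5`: approach (tent slab `|ΔRe| ≤ 0.15` empty, `z` in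
the near window), touching, atomic, charged (no real critical point of `f`: `|P′/P| ≤ 15 < 46`; `LocalA` kills every sign window), RemainderBox sup 48.4 ≤ 50,
λ = κ_v·Im v = 5.19 ≥ 3 — and `κ_v·s/η = 1.0376 > 1.005` (near field of the mate ALIGNED with the far field); stacked variants reach 1.17 (`lens2/wgamma_check.py`
177202268b7c07e4 / `.out` af706950). On the same frames the dissipation is LARGE: X = 5.5–7.6, and in the books' own currency X″ := ΔE·(η/s)² = 5.1–6.8.
Hence the option **(T″) `TouchedDissipationLawSQ c κ₀` (§2b): same population, conclusion `c·s² ≤ η²·ΔE`** — exactly what the glue consumes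
(`betaClassLaw_of_TS` in `TouchedGlue-sketch-v3opt.lean`: NO cap, NO θ in the currency), implied by `T′ c κ₀ ∧ Γ1(θ)` with constant `c/(1+θ)²`
(`lawSQ_of_lawQ_of_cap`, §3b), weaker than T′ wherever `κ_v ≤ η/s`, and benched for free: instr-1's cap column `κ_v·s/η ≤ 0.81` on all 22 886 rows gives
`X″ ≥ X/0.6561 ≥ 3.96` there. Corner `η = 0`: T″ then asserts «no β-level», as `T′ ∧ Γ1` already did (cap `κ_v ≤ 0`).

Nothing here bears on the truth of RH; RH is NOT proved; (T) / ★A / R1u / 33346 / 33347 OPEN; checked ≠ landed ≠ proved; census ≠ Lean. -/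

namespace RhW08.TouchedDissipation

open Complex
open scoped ComplexConjugate
open RhW08.Round1 RhW08.StSwap RhW08.Round2 RhW08.QuadW
open RhW08.SealSwap (PBot)
open RhW08.SealSwapQ RhW08.RateSplit RhW08.BurgersRate RhW08.BurgersRateG3
open RhIdea6.G17.W07C7 RhIdea6.G17.W07C7.Rev6 RhIdea6.G18.W07C8.Law421BirthS RhIdea6.G19.W07C11.Seam
open RhIdea6.G20.W07C12.Frac RhIdea6.G20.W07C12.StColP RhW07.C12.FieldSplit RhIdea6.G21.W07C13.TentMax
open RhW07.C14.TwoSided RhW07.C14.Classes RhW07.C14.Lineage RhW07.C14.Booking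

/-! ## §1 Objects (expressions in `iteratedDeriv`; no structure, no instance) -/

/-- §1 the TOUCH relation at level `j`: `z` is a zero of `f⁽ʲ⁾` STRICTLY TALLER than `v` whose closed axis-centred Jensen disc meets `v`'s —
`Im v < Im z ∧ |Re v − Re z| ≤ Im v + Im z` (the negation instance of R1a′'s separation binder C′ in `FarChildExistsLawSep`). -/
def Touches (f : ℂ → ℂ) (j : ℕ) (v z : ℂ) : Prop :=
  iteratedDeriv j f z = 0 ∧ v.im < z.im ∧ |v.re - z.re| ≤ v.im + z.im

/-- §1 the pair is ATOMIC at level `j`: every OTHER upper zero `u` of `f⁽ʲ⁾` is disc-separated from both `v` and `z`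
(`Im · + Im u < |Re · − Re u|`), i.e. the cluster of `v` is exactly `{v, z}` (W1's `P = 2`; lens-1's atomic two-pair class). -/
def AtomicPair (f : ℂ → ℂ) (j : ℕ) (v z : ℂ) : Prop :=
  ∀ u : ℂ, iteratedDeriv j f u = 0 → 0 < u.im → u ≠ v → u ≠ z → v.im + u.im < |v.re - u.re| ∧ z.im + u.im < |z.re - u.re|

/-- §1 the closed two-disc union `Ū = D̄_v ∪ D̄_z` of the axis-centred Jensen discs (`‖u − Re v‖ ≤ Im v` or `‖u − Re z‖ ≤ Im z`). -/
def pairUnion (v z : ℂ) : Set ℂ :=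
  {u : ℂ | ‖u - (v.re : ℂ)‖ ≤ v.im ∨ ‖u - (z.re : ℂ)‖ ≤ z.im}

/-- §1 the multiplicity-weighted ENERGY OF THE UPPER CHILDREN of `f⁽ʲ⁺¹⁾` off `Z(f⁽ʲ⁾)` inside a set `S`:
`Σᶠ_{u ∈ S, f⁽ʲ⁺¹⁾ u = 0, f⁽ʲ⁾ u ≠ 0, Im u > 0} ord(u)·Im u²` (the population W1 counts; `finsum` reads `0` on an infinite support, which a legal frame
never has). -/
noncomputable def childEnergy (f : ℂ → ℂ) (j : ℕ) (S : Set ℂ) : ℝ :=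
  ∑ᶠ u ∈ {u : ℂ | (iteratedDeriv (j + 1) f u = 0 ∧ iteratedDeriv j f u ≠ 0 ∧ u ∈ S) ∧ 0 < u.im},
    (analyticOrderNatAt (iteratedDeriv (j + 1) f) u : ℝ) * u.im ^ 2

/-- §1 the STATE FIELD MODULUS `κ_v := ‖tiltAt f j v‖` — the field the other zeros (partner `v̄` excluded) and the exponential factor exert AT the state
(`RhW08.BurgersRate.tiltAt` = `newtonK + i/(2·Im v)`; the column's κ_book). -/
noncomputable def stateKappa (f : ℂ → ℂ) (j : ℕ) (v : ℂ) : ℝ := ‖tiltAt f j v‖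

/-! ## §2 The law -/

/-- (LAW T′ = C′ — TOUCHED-LEVEL DISSIPATION ON APPROACH LEVELS; typed, OPEN; dimensionless; parameters `c` = dissipation constant, `κ₀` = floor)
on a legal frame, at a CHARGED APPROACH level `j` (`ApproachLevelQ`: neither far nor consumption — v2's added binder) with lowest band state `v` touched by a strictly taller zero `z` (`Touches`), the pair atomic (`AtomicPair`) and the state field above
the floor (`κ₀ ≤ Im v·κ_v`): the pair energy `Im v² + Im z²` exceeds the energy of the upper children of `f⁽ʲ⁺¹⁾` off `Z(f⁽ʲ⁾)` in `Ū = D̄_v ∪ D̄_z`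
(multiplicity-weighted) by at least `c/κ_v²`.  Column (instr-1): κ_book²·ΔE on touched charged levels by regime of κ·Im v; kill `> −c` above the floor. -/
def TouchedDissipationLawQ (c κ₀ : ℝ) : Prop :=
  ∀ (η : ℝ) (f : ℂ → ℂ) (x₀ s hmax R Hs : ℝ) (B : ℕ), EngineHyps5 2 η f x₀ s hmax R Hs B →
    ∀ (j : ℕ) (v z : ℂ), Charged (PTrkSQ PBot) StTrkDQ ReadyR2 η f x₀ s hmax R Hs B j → ApproachLevelQ η f x₀ s hmax R Hs B j →
      IsLowest StTrkDQ η f x₀ s hmax R Hs B j v → Touches f j v z → AtomicPair f j v z →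
      κ₀ ≤ v.im * stateKappa f j v →
      c ≤ ((v.im ^ 2 + z.im ^ 2) - childEnergy f j (pairUnion v z)) * stateKappa f j v ^ 2

/-- (LAW T-∃ — the constants EXISTENTIAL; typing checklist (iv)) some admissible `(c, κ₀)` — `1 ≤ c` («at least one isolated pair's rate») and
`0 < κ₀` — satisfies `TouchedDissipationLawQ c κ₀`.  Record candidates against the column: `(1, 2)`, `(1, 3)`; the first-order asymptote is `c = 3`. -/
def TouchedDissipationLawQEx : Prop :=
  ∃ c κ₀ : ℝ, 1 ≤ c ∧ 0 < κ₀ ∧ TouchedDissipationLawQ c κ₀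

/-! ## §2b (v3-OPTION) The law in the books' `s`-currency -/

/-- (LAW T″ — `s`-CURRENCY FORM, v3-option) same population as `TouchedDissipationLawQ` (charged APPROACH level, lowest band state `v` touched by a
strictly taller `z`, the pair atomic, the state field above the floor `κ₀ ≤ Im v·κ_v`); conclusion directly in the books' currency: **the pair energy
drops by at least `c·(s/η)²`**, written multiplied out `c·s² ≤ η²·((Im v² + Im z²) − childEnergy(Ū))`.  This is what the β potential consumes; no state
cap is needed downstream.  Benches: X″ := ΔE·(η/s)² ≥ 3.96 on instr-1's 22 886 rows (from X ≥ 2.596 and κ_v·s/η ≤ 0.81); 5.1–6.8 on the WΓ family. -/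
def TouchedDissipationLawSQ (c κ₀ : ℝ) : Prop :=
  ∀ (η : ℝ) (f : ℂ → ℂ) (x₀ s hmax R Hs : ℝ) (B : ℕ), EngineHyps5 2 η f x₀ s hmax R Hs B →
    ∀ (j : ℕ) (v z : ℂ), Charged (PTrkSQ PBot) StTrkDQ ReadyR2 η f x₀ s hmax R Hs B j → ApproachLevelQ η f x₀ s hmax R Hs B j →
      IsLowest StTrkDQ η f x₀ s hmax R Hs B j v → Touches f j v z → AtomicPair f j v z →
      κ₀ ≤ v.im * stateKappa f j v →
      c * s ^ 2 ≤ η ^ 2 * ((v.im ^ 2 + z.im ^ 2) - childEnergy f j (pairUnion v z))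

/-- (LAW T″-∃, v3-option) some admissible `(c, κ₀)`, `1 ≤ c`, `0 < κ₀`, satisfies `TouchedDissipationLawSQ c κ₀` (record instance to aim at: `(3/2, 3)`). -/
def TouchedDissipationLawSQEx : Prop :=
  ∃ c κ₀ : ℝ, 1 ≤ c ∧ 0 < κ₀ ∧ TouchedDissipationLawSQ c κ₀

/-! ## §3 Bookkeeping (K) -/

/-- (K) §3 any admissible instance gives the existential form. -/
theorem touchedDissipationLawQEx_of_instance {c κ₀ : ℝ} (hc : 1 ≤ c) (hκ : 0 < κ₀) (h : TouchedDissipationLawQ c κ₀) :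
    TouchedDissipationLawQEx :=
  ⟨c, κ₀, hc, hκ, h⟩

/-- (K) §3 the law is DOWNWARD-closed in the constant and UPWARD-closed in the floor: `c′ ≤ c`, `κ₀ ≤ κ₀′` ⇒ `T c κ₀ → T c′ κ₀′`. -/
theorem touchedDissipationLawQ_mono {c c' κ₀ κ₀' : ℝ} (hc : c' ≤ c) (hκ : κ₀ ≤ κ₀') (h : TouchedDissipationLawQ c κ₀) :
    TouchedDissipationLawQ c' κ₀' :=
  fun η f x₀ s hmax R Hs B hE j v z hch hA hlow ht ha hfl =>
    hc.trans (h η f x₀ s hmax R Hs B hE j v z hch hA hlow ht ha (hκ.trans hfl))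

/-- (K) §3 the child energy is non-negative. -/
theorem childEnergy_nonneg (f : ℂ → ℂ) (j : ℕ) (S : Set ℂ) : 0 ≤ childEnergy f j S :=
  finsum_nonneg fun u => finsum_nonneg fun _ => by positivity

/-- (K) §3 THE `s`-CURRENCY READING (pure algebra): a dimensionless drop `c ≤ ΔE·κ²` with `0 < c`, `0 ≤ κ` under a cap `κ ≤ λ·(η/s)` gives
`c·s² ≤ λ²·η²·ΔE` — with `λ = 1 + θ` this is the form the books' potential consumes («per touched level `E` loses ≥ c·s²/((1+θ)η)²»). -/
theorem sCurrency_of_dimensionless {c κ lam η s ΔE : ℝ} (hc : 0 < c) (hs : 0 < s) (hκ : 0 ≤ κ)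
    (hdrop : c ≤ ΔE * κ ^ 2) (hcap : κ ≤ lam * (η / s)) : c * s ^ 2 ≤ lam ^ 2 * η ^ 2 * ΔE := by
  have hΔ : 0 ≤ ΔE := by
    by_contra hneg
    push Not at hneg
    nlinarith [sq_nonneg κ]
  have hcap2 : κ ^ 2 ≤ (lam * (η / s)) ^ 2 := pow_le_pow_left₀ hκ hcap 2
  have h1 : c * s ^ 2 ≤ ΔE * κ ^ 2 * s ^ 2 := mul_le_mul_of_nonneg_right hdrop (sq_nonneg s)
  have h2 : ΔE * κ ^ 2 * s ^ 2 ≤ ΔE * (lam * (η / s)) ^ 2 * s ^ 2 :=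
    mul_le_mul_of_nonneg_right (mul_le_mul_of_nonneg_left hcap2 hΔ) (sq_nonneg s)
  have h3 : ΔE * (lam * (η / s)) ^ 2 * s ^ 2 = lam ^ 2 * η ^ 2 * ΔE := by
    field_simp
  rw [h3] at h2
  exact h1.trans h2

/-- (K) §3 the law's conclusion at a level, read in the `s`-currency under a state cap `κ_v ≤ (1+θ)·η/s`:
`c·s² ≤ (1+θ)²·η²·(Im v² + Im z² − childEnergy)`. -/
theorem sCurrency_at_level {c κ₀ θ : ℝ} (hc : 0 < c) (hT : TouchedDissipationLawQ c κ₀)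
    {η : ℝ} {f : ℂ → ℂ} {x₀ s hmax R Hs : ℝ} {B : ℕ} (hE : EngineHyps5 2 η f x₀ s hmax R Hs B)
    {j : ℕ} {v z : ℂ} (hch : Charged (PTrkSQ PBot) StTrkDQ ReadyR2 η f x₀ s hmax R Hs B j) (hA : ApproachLevelQ η f x₀ s hmax R Hs B j)
    (hlow : IsLowest StTrkDQ η f x₀ s hmax R Hs B j v) (ht : Touches f j v z) (ha : AtomicPair f j v z)
    (hfl : κ₀ ≤ v.im * stateKappa f j v) (hcap : stateKappa f j v ≤ (1 + θ) * (η / s)) :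
    c * s ^ 2 ≤ (1 + θ) ^ 2 * η ^ 2 * ((v.im ^ 2 + z.im ^ 2) - childEnergy f j (pairUnion v z)) := by
  have hs : 0 < s := hE.2.2.2.1
  exact sCurrency_of_dimensionless hc hs (norm_nonneg _) (hT η f x₀ s hmax R Hs B hE j v z hch hA hlow ht ha hfl) hcap


/-! ## §3b (v3-OPTION) Bookkeeping of the `s`-currency form (K) -/

/-- (K) §3b T″ is downward-closed in the constant and upward-closed in the floor. -/
theorem touchedDissipationLawSQ_mono {c c' κ₀ κ₀' : ℝ} (hc : c' ≤ c) (hκ : κ₀ ≤ κ₀') (h : TouchedDissipationLawSQ c κ₀) :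
    TouchedDissipationLawSQ c' κ₀' :=
  fun η f x₀ s hmax R Hs B hE j v z hch hA hlow ht ha hfl =>
    (mul_le_mul_of_nonneg_right hc (sq_nonneg s)).trans (h η f x₀ s hmax R Hs B hE j v z hch hA hlow ht ha (hκ.trans hfl))

/-- (K) §3b any admissible instance gives the existential form of T″. -/
theorem touchedDissipationLawSQEx_of_instance {c κ₀ : ℝ} (hc : 1 ≤ c) (hκ : 0 < κ₀) (h : TouchedDissipationLawSQ c κ₀) :
    TouchedDissipationLawSQEx :=
  ⟨c, κ₀, hc, hκ, h⟩

/-- ★ (K) §3b **T′ + STATE CAP ⟹ T″** with constant `c/(1+θ)²`: the dimensionless law `TouchedDissipationLawQ c κ₀` together with a β-level state cap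
`κ_v ≤ (1+θ)·η/s` (the glue's Γ1, spelled out) gives the `s`-currency law — so T″ is WEAKER than the pair (T′, Γ1) the v2 glue assumed. -/
theorem lawSQ_of_lawQ_of_cap {c κ₀ θ : ℝ} (hθ : 0 ≤ θ) (hc : 0 < c) (hT : TouchedDissipationLawQ c κ₀)
    (hcap : ∀ (η : ℝ) (f : ℂ → ℂ) (x₀ s hmax R Hs : ℝ) (B : ℕ), EngineHyps5 2 η f x₀ s hmax R Hs B →
      ∀ (j : ℕ) (v z : ℂ), Charged (PTrkSQ PBot) StTrkDQ ReadyR2 η f x₀ s hmax R Hs B j → ApproachLevelQ η f x₀ s hmax R Hs B j →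
        IsLowest StTrkDQ η f x₀ s hmax R Hs B j v → Touches f j v z → AtomicPair f j v z → κ₀ ≤ v.im * stateKappa f j v →
        stateKappa f j v ≤ (1 + θ) * (η / s)) :
    TouchedDissipationLawSQ (c / (1 + θ) ^ 2) κ₀ := by
  intro η f x₀ s hmax R Hs B hE j v z hch hA hlow ht ha hfl
  have h1 : 0 < (1 + θ) ^ 2 := by positivity
  have hsc := sCurrency_at_level hc hT hE hch hA hlow ht ha hfl (hcap η f x₀ s hmax R Hs B hE j v z hch hA hlow ht ha hfl)
  rw [div_mul_eq_mul_div, div_le_iff₀ h1]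
  linarith

/-- (K) §3b conversely-shaped reading: T″ at a level gives a NON-NEGATIVE energy drop (`0 < s`, `0 < c`). -/
theorem drop_nonneg_of_lawSQ {c κ₀ : ℝ} (hc : 0 < c) (hT : TouchedDissipationLawSQ c κ₀)
    {η : ℝ} {f : ℂ → ℂ} {x₀ s hmax R Hs : ℝ} {B : ℕ} (hE : EngineHyps5 2 η f x₀ s hmax R Hs B)
    {j : ℕ} {v z : ℂ} (hch : Charged (PTrkSQ PBot) StTrkDQ ReadyR2 η f x₀ s hmax R Hs B j) (hA : ApproachLevelQ η f x₀ s hmax R Hs B j)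
    (hlow : IsLowest StTrkDQ η f x₀ s hmax R Hs B j v) (ht : Touches f j v z) (ha : AtomicPair f j v z)
    (hfl : κ₀ ≤ v.im * stateKappa f j v) :
    0 ≤ (v.im ^ 2 + z.im ^ 2) - childEnergy f j (pairUnion v z) := by
  have hs : 0 < s := hE.2.2.2.1
  have h := hT η f x₀ s hmax R Hs B hE j v z hch hA hlow ht ha hfl
  by_contra hneg
  push Not at hneg
  nlinarith [sq_nonneg η, mul_pos hc (pow_pos hs 2)]

end RhW08.TouchedDissipation
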